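import Summits.QuantumFields.YangMills.Theorems.LuscherReductionTwistedTraceScalingBTRatesAtoms
import HarnessLib

/-!
# (B-T) RATES, part 3: the three exponential budgets (H1)–(H3) of the tail, eventually along the schedule
# (lane A of S-BASE, crux `TwistedTraceScaling` stmt-QuantumFields-20203, C4-CORE, the (B-T) pen; design note `pub/ym-fleet/ym-luscher-20007-p1/COARSE-DESIGN.md` §25.9)

Pure real analysis of the schedule of `…BTSchedule` (`r = x = β^{-1/2}` eventually, `ε = β^{-1}`, `α = xℓ`, `R₁ = 5xℓ`, `δ = δ₁ = 14β^{-s}/|Site|`, `ℓ = log β`):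
* `eventually_exp_logsq_le` — the one comparison behind all three budgets: `exp(K − q·log²β) ≤ C·(β^{-1})^m` eventually (`q, C > 0`);
* `eventually_btM0_le` — the tail exponent `βM₀ ≤ 14|E| + 100 N_P + 1` eventually (`βr² = 1`);
* `btMnt_ge_sq`, `btMfar_ge_min` and ★ `eventually_btMnt_ge` (`log²β ≤ β·m_nt`), ★ `eventually_btMfar_ge` (`q_L·log²β ≤ β·m_far`, `s < 1/2`);
* `budget_rhs_ge`, `budget_rhs_ge'` — the right-hand sides are `≥ C_L·(β^{-1})^{3|Site|+6}` (Haar floor `…BTHaarFloor.gaugeMeasure_real_gaugeCore_ge`); no new definitions;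
* ★★ `eventually_budget` — ALL SIX conjuncts of the budget hypothesis `hbudget` of `…BTSchedule.recordBT_hT_of_eventually`.
HONEST FRAMING: a stub of a child of the CONDITIONAL reduction route R2b1; C4-CORE OPEN; not infinite volume, not a gap, not Clay.
-/

set_option autoImplicit false

noncomputable section

open MeasureTheory Filter Topology Real Asymptotics
open scoped BigOperators
open Literature.MathematicalPhysics.QuantumFieldTheory
open Literature.MathematicalPhysics.QuantumLattice

namespace Summit.QuantumFields.YangMills.Theorems.FemtoTransferGap.TwoLattice.ConstTube

open Summit.QuantumFields.YangMills.Theorems.FemtoTransferGap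
open Summit.QuantumFields.YangMills.Theorems.FemtoTransferGap.TwoLattice
open Summit.QuantumFields.YangMills.Theorems.FemtoTransferGap.TwoLattice.Avg
open Summit.QuantumFields.YangMills.Theorems.FemtoTransferGap.TwoLattice.Stiff (LinkSpace)
open Summit.QuantumFields.YangMills.Theorems.FemtoTransferGap.TwoLattice.Cov

variable {L : ℕ} [NeZero L]

/-! ## §1 The generic comparison `exp(K − q log²β) ≤ C β^{-m}` -/

omit [NeZero L] in
/-- `exp(K − q·log²β) ≤ C·(β^{-1})^m` eventually, for `q, C > 0`. [folklore] -/
theorem eventually_exp_logsq_le {K q C : ℝ} (hq : 0 < q) (hC : 0 < C) (m : ℕ) :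
    ∀ᶠ β : ℝ in atTop, Real.exp (K - q * Real.log β ^ 2) ≤ C * powScale 1 β ^ m := by
  filter_upwards [eventually_ge_atTop (1 : ℝ), eventually_ge_atTop (Real.exp (max 1 ((m + |K| + |Real.log C|) / q)))] with β hβ1 hβT
  have hβ0 : 0 < β := by linarith
  have htT : max 1 ((m + |K| + |Real.log C|) / q) ≤ Real.log β := by
    rw [← Real.log_exp (max 1 _)]; exact Real.log_le_log (Real.exp_pos _) hβT
  set t := Real.log β with ht
  have ht1 : 1 ≤ t := le_trans (le_max_left _ _) htT
  have hqt : (m : ℝ) + |K| + |Real.log C| ≤ q * t := by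
    have := le_trans (le_max_right _ _) htT
    rw [div_le_iff₀ hq] at this; linarith
  have hy : powScale 1 β = Real.exp (-t) := by
    rw [powScale_eq hβ1, Real.rpow_neg_one, ht, Real.exp_neg, Real.exp_log hβ0]
  have hCe : C = Real.exp (Real.log C) := (Real.exp_log hC).symm
  rw [hy, ← Real.exp_nat_mul, hCe, ← Real.exp_add, Real.exp_le_exp]
  have h1 : ((m : ℝ) + |K| + |Real.log C|) * t ≤ q * t * t := mul_le_mul_of_nonneg_right hqt (by linarith)
  have h2 : |K| + |Real.log C| ≤ (|K| + |Real.log C|) * t := le_mul_of_one_le_right (by positivity) ht1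
  have hK := le_abs_self K
  have hC' := neg_abs_le (Real.log C)
  have hsq : q * t ^ 2 = q * t * t := by ring
  rw [hsq]; linarith

/-! ## §2 The tail exponent `βM₀` is bounded -/

/-- Eventually `βM₀ ≤ 14|E| + 100N_P + 1` (`M₀ = |E|(2ε/3 + 2√2 r)² + (10√N_P r)² + E(r,0)`, `βr² = 1`, `ε ≤ r`). [folklore] -/
theorem eventually_btM0_le : ∀ᶠ β : ℝ in atTop,
    β * ((Fintype.card (Edge 3 L) : ℝ) * (2 * (btEps β / 3) + 2 * Real.sqrt 2 * btRad β) ^ 2) +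
        β * ((10 * Real.sqrt (Fintype.card (Plaquette 3 L × Fin 3)) * btRad β) ^ 2 + stepActionErr (L := L) (btRad β) 0) ≤
      14 * Fintype.card (Edge 3 L) + 100 * Fintype.card (Plaquette 3 L × Fin 3) + 1 := by
  have hE : (0 : ℝ) ≤ Fintype.card (Edge 3 L) := Nat.cast_nonneg _
  have hNP : (0 : ℝ) ≤ Fintype.card (Plaquette 3 L × Fin 3) := Nat.cast_nonneg _
  have hNpl : (0 : ℝ) ≤ Fintype.card (Plaquette 3 L) := Nat.cast_nonneg _
  filter_upwards [eventually_ge_atTop (1 : ℝ), eventually_btRad_eq,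
    (tendsto_powScale (show (0 : ℝ) < 1 / 2 by norm_num)).eventually
      (eventually_le_nhds (show (0 : ℝ) < 1 / (729945 * (Fintype.card (Plaquette 3 L) : ℝ) + 1) by positivity))] with β hβ1 hreq hxs
  set x := powScale (1 / 2) β with hxdef
  set E := (Fintype.card (Edge 3 L) : ℝ)
  set NP := (Fintype.card (Plaquette 3 L × Fin 3) : ℝ)
  set Npl := (Fintype.card (Plaquette 3 L) : ℝ)
  have hβ0 : 0 ≤ β := by linarith
  have hx0 : 0 < x := powScale_pos _ _
  have hx1 : x ≤ 1 := powScale_le_one (by norm_num) β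
  have hβx : β * x ^ 2 = 1 := mul_powScale_half_sq hβ1
  have hεx : btEps β ≤ x := by unfold btEps; exact powScale_le_powScale (by norm_num) β
  have hε0 : 0 ≤ btEps β := (btEps_pos_le β).1.le
  have h2 : Real.sqrt 2 ≤ 3 / 2 := by rw [Real.sqrt_le_left (by norm_num)]; norm_num
  have hs20 : 0 ≤ Real.sqrt 2 := Real.sqrt_nonneg _
  rw [hreq]
  have t1 : β * (E * (2 * (btEps β / 3) + 2 * Real.sqrt 2 * x) ^ 2) ≤ 14 * E := by
    have e2x : Real.sqrt 2 * x ≤ 3 / 2 * x := mul_le_mul_of_nonneg_right h2 hx0.le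
    have hin : 2 * (btEps β / 3) + 2 * Real.sqrt 2 * x ≤ 11 / 3 * x := by linarith
    have hin0 : 0 ≤ 2 * (btEps β / 3) + 2 * Real.sqrt 2 * x := by positivity
    have hsq : (2 * (btEps β / 3) + 2 * Real.sqrt 2 * x) ^ 2 ≤ (11 / 3 * x) ^ 2 := pow_le_pow_left₀ hin0 hin 2
    calc β * (E * (2 * (btEps β / 3) + 2 * Real.sqrt 2 * x) ^ 2) ≤ β * (E * (11 / 3 * x) ^ 2) := by gcongr
      _ = 121 / 9 * E * (β * x ^ 2) := by ring
      _ ≤ 14 * E := by rw [hβx, mul_one]; linarith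
  have hsqNP : Real.sqrt NP ^ 2 = NP := Real.sq_sqrt hNP
  have t2 : β * (10 * Real.sqrt NP * x) ^ 2 = 100 * NP := by
    calc β * (10 * Real.sqrt NP * x) ^ 2 = 100 * Real.sqrt NP ^ 2 * (β * x ^ 2) := by ring
      _ = 100 * NP := by rw [hsqNP, hβx, mul_one]
  have t3 : β * stepActionErr (L := L) x 0 ≤ 1 := by
    unfold stepActionErr
    rw [Real.sqrt_zero]
    have e : β * (Npl * (1728 * x ^ 2 * 0 + 29376 * x ^ 3 + 700569 * x ^ 4)) = Npl * (29376 * x + 700569 * x ^ 2) * (β * x ^ 2) := by ring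
    rw [e, hβx, mul_one]
    have hx2 : x ^ 2 ≤ x := by nlinarith
    have h3 : Npl * (29376 * x + 700569 * x ^ 2) ≤ Npl * (729945 * x) := mul_le_mul_of_nonneg_left (by linarith) hNpl
    have hx' : x * (729945 * Npl + 1) ≤ 1 := by rwa [le_div_iff₀ (by positivity)] at hxs
    linarith
  rw [mul_add β]
  linarith

/-! ## §3 Floors for the two defect masses -/

omit [NeZero L] in
/-- `m² ≤ m_nt` as soon as `0 ≤ m` lies below both branches of the `min`. [folklore] -/
theorem btMnt_ge_sq {δ α R R₁ ε m : ℝ} (hm : 0 ≤ m) (h1 : m ≤ R₁ / 2 - 2 * (Real.sqrt 2 * R + δ) * ε - (2 * Real.sqrt 2 * R + α))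
    (h2 : m ≤ 1 / (3 * L) - 4 * (Real.sqrt 2 * R + δ) - (2 * Real.sqrt 2 * R + α)) : m ^ 2 ≤ btMnt L δ α R R₁ ε := by
  unfold btMnt; exact pow_le_pow_left₀ hm (le_min h1 h2) 2

/-- `min(m₁², m₂²/|E|) ≤ m_far` as soon as `0 ≤ m₁, m₂` lie below the two branches. [folklore] -/
theorem btMfar_ge_min {δ α R ε P₀ m₁ m₂ : ℝ} (hm₁ : 0 ≤ m₁) (hm₂ : 0 ≤ m₂) (h1 : m₁ ≤ P₀ - 4 * (Real.sqrt 2 * R + δ) - (2 * Real.sqrt 2 * R + 2 * δ))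
    (h2 : m₂ ≤ Fintype.card (Site 3 L) * (1 - 3 * L * P₀) * α -
      (2 * ε * Fintype.card (Site 3 L) * δ + 2 * R ^ 2 + 2 * Real.sqrt 2 * Fintype.card (Site 3 L) * (9 * L * P₀ + ε) * R)) :
    min (m₁ ^ 2) (m₂ ^ 2 / Fintype.card (Edge 3 L)) ≤ btMfar L δ α R ε P₀ := by
  unfold btMfar
  exact min_le_min (pow_le_pow_left₀ hm₁ h1 2) (div_le_div_of_nonneg_right (pow_le_pow_left₀ hm₂ h2 2) (Nat.cast_nonneg _))

/-- ★ Eventually `log²β ≤ β·m_nt(schedule)`: both branches of `m_nt` exceed `xℓ`, and `βx²ℓ² = ℓ²`. [folklore] -/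
theorem eventually_btMnt_ge {s : ℝ} (hs : 0 < s) (hs2 : s < 1 / 2) :
    ∀ᶠ β : ℝ in atTop, Real.log β ^ 2 ≤ β * btMnt L (recordDelta1 L s β) (btAlpha β) (btRad β) (btR1 β) (btEps β) := by
  have hL1 : (1 : ℝ) ≤ L := by exact_mod_cast NeZero.one_le
  have hL0 : (0 : ℝ) < L := by linarith
  have hN : (0 : ℝ) < Fintype.card (Site 3 L) := by exact_mod_cast Fintype.card_pos
  filter_upwards [eventually_schedule_facts (L := L) hs hs2, eventually_ge_atTop (Real.exp 14)] with β hf hβ14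
  obtain ⟨hβ1, hℓeq, -, hreq, hεx, hxδ, hxℓ, -, hδs, -, hδhalf⟩ := hf
  have hℓ14 : 14 ≤ Real.log β := by rw [← Real.log_exp 14]; exact Real.log_le_log (Real.exp_pos _) hβ14
  set x := powScale (1 / 2) β with hxdef
  set δ := recordDelta1 L s β with hδdef
  set ℓ := Real.log β with hℓdef
  have hx0 : 0 < x := powScale_pos _ _
  have hx1 : x ≤ 1 := powScale_le_one (by norm_num) β
  have hδ0 : 0 ≤ δ := by rw [hδdef]; unfold recordDelta1; exact div_nonneg (mul_nonneg (by norm_num) (powScale_pos _ _).le) hN.le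
  have hε0 : 0 ≤ btEps β := (btEps_pos_le β).1.le
  have hβx : β * x ^ 2 = 1 := mul_powScale_half_sq hβ1
  have hαeq : btAlpha β = x * ℓ := by unfold btAlpha; rw [hℓeq]
  have hR₁eq : btR1 β = 5 * x * ℓ := by unfold btR1; rw [hℓeq]
  have h2 : Real.sqrt 2 ≤ 3 / 2 := by rw [Real.sqrt_le_left (by norm_num)]; norm_num
  have hs20 : 0 ≤ Real.sqrt 2 := Real.sqrt_nonneg _
  have hxℓ0 : 0 ≤ x * ℓ := by positivity
  have hkey : (x * ℓ) ^ 2 ≤ btMnt L δ (btAlpha β) (btRad β) (btR1 β) (btEps β) := by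
    refine btMnt_ge_sq (L := L) hxℓ0 ?_ ?_
    · rw [hreq, hαeq, hR₁eq]
      have e2x : Real.sqrt 2 * x ≤ 3 / 2 * x := mul_le_mul_of_nonneg_right h2 hx0.le
      have hx2 : x ^ 2 ≤ x := by nlinarith
      have e1 : 2 * (Real.sqrt 2 * x + δ) * btEps β ≤ 4 * x := by
        have h3 : Real.sqrt 2 * x + δ ≤ 3 / 2 * x + 1 / 2 := by linarith
        have h4 : 2 * (Real.sqrt 2 * x + δ) * btEps β ≤ 2 * (3 / 2 * x + 1 / 2) * x :=
          mul_le_mul (by linarith) hεx hε0 (by positivity)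
        have h5 : 2 * (3 / 2 * x + 1 / 2) * x = 3 * x ^ 2 + x := by ring
        linarith
      have e3 : x * 14 ≤ x * ℓ := mul_le_mul_of_nonneg_left hℓ14 hx0.le
      linarith
    · rw [hreq, hαeq]
      have e2x : Real.sqrt 2 * x ≤ 3 / 2 * x := mul_le_mul_of_nonneg_right h2 hx0.le
      have hu60 : (1 : ℝ) / (60 * L) = 1 / (3 * L) / 20 := by ring
      have hu4000 : (1 : ℝ) / (4000 * L) = 1 / (3 * L) * (3 / 4000) := by ring
      have hu0 : (0 : ℝ) < 1 / (3 * L) := by positivity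
      rw [hu60] at hxℓ
      rw [hu4000] at hδs
      have hx9 : 9 * x ≤ δ := by linarith
      linarith
  calc ℓ ^ 2 = β * (x * ℓ) ^ 2 := by rw [mul_pow, ← mul_assoc, hβx, one_mul]
    _ ≤ β * btMnt L δ (btAlpha β) (btRad β) (btR1 β) (btEps β) := mul_le_mul_of_nonneg_left hkey (by linarith)

/-- Eventually `log²β ≤ β·β^{-2s}` (`s < 1/2`). [folklore] -/
theorem eventually_logsq_le_mul_powScale {s : ℝ} (hs2 : s < 1 / 2) : ∀ᶠ β : ℝ in atTop, Real.log β ^ 2 ≤ β * powScale (2 * s) β := by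
  have h := (isLittleO_log_rpow_rpow_atTop 2 (show (0 : ℝ) < 1 - 2 * s by linarith)).bound (show (0 : ℝ) < 1 by norm_num)
  filter_upwards [h, eventually_ge_atTop (1 : ℝ)] with β hb hβ1
  have hβ0 : 0 < β := by linarith
  rw [one_mul, Real.norm_eq_abs, Real.norm_eq_abs, Real.rpow_two, abs_of_nonneg (sq_nonneg _), abs_of_nonneg (Real.rpow_nonneg hβ0.le _)] at hb
  have e : β * powScale (2 * s) β = β ^ (1 - 2 * s) := by
    rw [powScale_eq hβ1, show (1 : ℝ) - 2 * s = 1 + -(2 * s) by ring, Real.rpow_add hβ0, Real.rpow_one]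
  rw [e]; exact hb

/-- ★ Eventually `q_L·log²β ≤ β·m_far(schedule)` (`s < 1/2`): the rough branch is `≥ (6δ)²` with `βδ² ≫ log²β`, the signal branch is `≥ (|Site|xℓ/4)²/|E|`. [folklore] -/
theorem eventually_btMfar_ge {s : ℝ} (hs : 0 < s) (hs2 : s < 1 / 2) :
    ∃ q : ℝ, 0 < q ∧ ∀ᶠ β : ℝ in atTop, q * Real.log β ^ 2 ≤
      β * btMfar L (recordDelta1 L s β) (btAlpha β) (btRad β) (btEps β) (13 * recordDelta1 L s β) := by
  have hL1 : (1 : ℝ) ≤ L := by exact_mod_cast NeZero.one_le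
  have hL0 : (0 : ℝ) < L := by linarith
  have hN : (0 : ℝ) < Fintype.card (Site 3 L) := by exact_mod_cast Fintype.card_pos
  have hN1 : (1 : ℝ) ≤ Fintype.card (Site 3 L) := by exact_mod_cast Fintype.card_pos
  have hE : (0 : ℝ) < Fintype.card (Edge 3 L) := by exact_mod_cast Fintype.card_pos
  set q : ℝ := min (36 * 196 / (Fintype.card (Site 3 L) : ℝ) ^ 2) ((Fintype.card (Site 3 L) : ℝ) ^ 2 / (16 * Fintype.card (Edge 3 L))) with hqdef
  refine ⟨q, lt_min (by positivity) (by positivity), ?_⟩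
  filter_upwards [eventually_schedule_facts (L := L) hs hs2, eventually_ge_atTop (Real.exp 14), eventually_logsq_le_mul_powScale hs2] with β hf hβ14 hlog
  obtain ⟨hβ1, hℓeq, -, hreq, hεx, hxδ, -, -, hδs, hεs, hδhalf⟩ := hf
  have hℓ14 : 14 ≤ Real.log β := by rw [← Real.log_exp 14]; exact Real.log_le_log (Real.exp_pos _) hβ14
  set x := powScale (1 / 2) β with hxdef
  set δ := recordDelta1 L s β with hδdef
  set ℓ := Real.log β with hℓdef
  set N := (Fintype.card (Site 3 L) : ℝ) with hNdef
  have hβ0 : 0 < β := by linarith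
  have hx0 : 0 < x := powScale_pos _ _
  have hx1 : x ≤ 1 := powScale_le_one (by norm_num) β
  have hδ0 : 0 ≤ δ := by rw [hδdef]; unfold recordDelta1; exact div_nonneg (mul_nonneg (by norm_num) (powScale_pos _ _).le) hN.le
  have hε0 : 0 ≤ btEps β := (btEps_pos_le β).1.le
  have hβx : β * x ^ 2 = 1 := mul_powScale_half_sq hβ1
  have hαeq : btAlpha β = x * ℓ := by unfold btAlpha; rw [hℓeq]
  have h2 : Real.sqrt 2 ≤ 3 / 2 := by rw [Real.sqrt_le_left (by norm_num)]; norm_num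
  have hs20 : 0 ≤ Real.sqrt 2 := Real.sqrt_nonneg _
  have hLδ : (L : ℝ) * δ < 1 / 4000 := by
    have := mul_lt_mul_of_pos_left hδs hL0; rwa [show (L : ℝ) * (1 / (4000 * L)) = 1 / 4000 by field_simp] at this
  -- the two branches
  have hm₁ : 6 * δ ≤ 13 * δ - 4 * (Real.sqrt 2 * btRad β + δ) - (2 * Real.sqrt 2 * btRad β + 2 * δ) := by
    rw [hreq]
    have e2 : 6 * Real.sqrt 2 * x ≤ 9 * x := by nlinarith
    have hx9 : 9 * x ≤ δ := by linarith
    linarith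
  have hm₂ : N * (x * ℓ) / 4 ≤ N * (1 - 3 * L * (13 * δ)) * btAlpha β -
      (2 * btEps β * N * δ + 2 * btRad β ^ 2 + 2 * Real.sqrt 2 * N * (9 * L * (13 * δ) + btEps β) * btRad β) := by
    rw [hreq, hαeq]
    have hℓ0 : 0 ≤ ℓ := by linarith
    have hxℓ0 : 0 ≤ x * ℓ := by positivity
    have hNx : 0 ≤ N * x := by positivity
    have h39 : 1 / 2 ≤ 1 - 3 * (L : ℝ) * (13 * δ) := by linarith
    have hsig : N * (1 / 2) * (x * ℓ) ≤ N * (1 - 3 * L * (13 * δ)) * (x * ℓ) := by gcongr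
    have j1 : 2 * btEps β * N * δ ≤ N * x := by
      have h := mul_le_mul hεx hδhalf hδ0 hx0.le
      have := mul_le_mul_of_nonneg_left h (by positivity : (0 : ℝ) ≤ 2 * N)
      have e : 2 * N * (btEps β * δ) = 2 * btEps β * N * δ := by ring
      have e' : 2 * N * (x * (1 / 2)) = N * x := by ring
      linarith
    have j2 : 2 * x ^ 2 ≤ N * x := by
      have hx56 : x ≤ 1 / 2 := by linarith
      have h := mul_le_mul_of_nonneg_left hx56 hx0.le
      have h' : x ≤ N * x := le_mul_of_one_le_left hx0.le hN1
      nlinarith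
    have j3 : 2 * Real.sqrt 2 * N * (9 * L * (13 * δ) + btEps β) * x ≤ 3 * (31 / 1000) * (N * x) := by
      have hin : 9 * (L : ℝ) * (13 * δ) + btEps β ≤ 31 / 1000 := by linarith
      have hin0 : 0 ≤ 9 * (L : ℝ) * (13 * δ) + btEps β := by positivity
      have h22 : 2 * Real.sqrt 2 ≤ 3 := by linarith
      calc 2 * Real.sqrt 2 * N * (9 * L * (13 * δ) + btEps β) * x = 2 * Real.sqrt 2 * (9 * L * (13 * δ) + btEps β) * (N * x) := by ring
        _ ≤ 3 * (31 / 1000) * (N * x) := mul_le_mul_of_nonneg_right (mul_le_mul h22 hin hin0 (by norm_num)) hNx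
    have hℓN : N * x * 14 ≤ N * x * ℓ := mul_le_mul_of_nonneg_left hℓ14 hNx
    linarith
  have hfloor := btMfar_ge_min (L := L) (by positivity : (0 : ℝ) ≤ 6 * δ) (by positivity : 0 ≤ N * (x * ℓ) / 4) hm₁ hm₂
  -- multiply by `β` and compare with `q_L ℓ²`
  have hq1 : q * ℓ ^ 2 ≤ β * (6 * δ) ^ 2 := by
    have hδeq : δ = 14 * powScale s β / N := rfl
    have hp2 : powScale s β ^ 2 = powScale (2 * s) β := by
      rw [powScale_eq hβ1, powScale_eq hβ1, ← Real.rpow_mul_natCast hβ0.le]; congr 1; push_cast; ring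
    have e : β * (6 * δ) ^ 2 = 36 * 196 / N ^ 2 * (β * powScale (2 * s) β) := by rw [hδeq, ← hp2]; ring
    rw [e]
    calc q * ℓ ^ 2 ≤ 36 * 196 / N ^ 2 * ℓ ^ 2 := mul_le_mul_of_nonneg_right (min_le_left _ _) (sq_nonneg _)
      _ ≤ 36 * 196 / N ^ 2 * (β * powScale (2 * s) β) := mul_le_mul_of_nonneg_left hlog (by positivity)
  have hq2 : q * ℓ ^ 2 ≤ β * ((N * (x * ℓ) / 4) ^ 2 / Fintype.card (Edge 3 L)) := by
    have e : β * ((N * (x * ℓ) / 4) ^ 2 / Fintype.card (Edge 3 L)) = N ^ 2 / (16 * Fintype.card (Edge 3 L)) * ℓ ^ 2 * (β * x ^ 2) := by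
      ring
    rw [e, hβx, mul_one]
    exact mul_le_mul_of_nonneg_right (min_le_right _ _) (sq_nonneg _)
  calc q * ℓ ^ 2 ≤ β * min ((6 * δ) ^ 2) ((N * (x * ℓ) / 4) ^ 2 / Fintype.card (Edge 3 L)) := by
        rw [mul_min_of_nonneg _ _ hβ0.le]; exact le_min hq1 hq2
    _ ≤ _ := mul_le_mul_of_nonneg_left hfloor hβ0.le

/-! ## §4 The right-hand sides are polynomial in `β^{-1}` -/

/-- For `β ≥ 1`: `β^{-9/2}`-factor and Haar floor give `C_L·(β^{-1})^{3|Site|+6} ≤ β^{-1}/3 · Haar(gaugeCore(ε/3)) · e^{-3}(L³β)^{-9/2}/2000`. [folklore] -/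
theorem budget_rhs_ge : ∃ C : ℝ, 0 < C ∧ ∀ β : ℝ, 1 ≤ β →
    C * powScale 1 β ^ (3 * Fintype.card (Site 3 L) + 6) ≤
      powScale 1 β / 3 * (gaugeMeasure L).real (gaugeCore L (btEps β / 3)) * (Real.exp (-3) * ((L : ℝ) ^ 3 * β) ^ (-(9 : ℝ) / 2) / 2000) := by
  have hL0 : (0 : ℝ) < L := by exact_mod_cast NeZero.pos L
  have hL92 : 0 < ((L : ℝ) ^ 3) ^ (-(9 : ℝ) / 2) := Real.rpow_pos_of_pos (by positivity) _
  refine ⟨Real.exp (-3) * ((L : ℝ) ^ 3) ^ (-(9 : ℝ) / 2) / (3 * 270 ^ Fintype.card (Site 3 L) * 2000), by positivity, fun β hβ1 => ?_⟩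
  have hβ0 : 0 < β := by linarith
  set y := powScale 1 β with hydef
  have hy0 : 0 < y := powScale_pos _ _
  have hy1 : y ≤ 1 := powScale_le_one zero_le_one β
  have hεy : btEps β = y := by rw [hydef]; rfl
  -- Haar floor
  have hG : y ^ (3 * Fintype.card (Site 3 L)) / 270 ^ Fintype.card (Site 3 L) ≤ (gaugeMeasure L).real (gaugeCore L (btEps β / 3)) := by
    have hρ0 : 0 < btEps β / 3 := by rw [hεy]; positivity
    have hρ1 : btEps β / 3 ≤ 1 := by rw [hεy]; linarith
    have h := gaugeMeasure_real_gaugeCore_ge (L := L) hρ0 hρ1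
    have e : ((btEps β / 3) ^ 3 / 10) ^ Fintype.card (Site 3 L) = y ^ (3 * Fintype.card (Site 3 L)) / 270 ^ Fintype.card (Site 3 L) := by
      rw [hεy, pow_mul, ← div_pow]; congr 1; ring
    rw [e] at h
    exact h
  -- the `β^{-9/2}` factor
  have h92 : ((L : ℝ) ^ 3 * β) ^ (-(9 : ℝ) / 2) = ((L : ℝ) ^ 3) ^ (-(9 : ℝ) / 2) * β ^ (-(9 : ℝ) / 2) := Real.mul_rpow (by positivity) hβ0.le
  have hy5 : y ^ 5 ≤ β ^ (-(9 : ℝ) / 2) := by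
    have e : y ^ 5 = β ^ (-(5 : ℝ)) := by
      rw [hydef, powScale_eq hβ1, ← Real.rpow_mul_natCast hβ0.le]; norm_num
    rw [e]; exact Real.rpow_le_rpow_of_exponent_le hβ1 (by norm_num)
  calc Real.exp (-3) * ((L : ℝ) ^ 3) ^ (-(9 : ℝ) / 2) / (3 * 270 ^ Fintype.card (Site 3 L) * 2000) * y ^ (3 * Fintype.card (Site 3 L) + 6)
        = y / 3 * (y ^ (3 * Fintype.card (Site 3 L)) / 270 ^ Fintype.card (Site 3 L)) *
            (Real.exp (-3) * (((L : ℝ) ^ 3) ^ (-(9 : ℝ) / 2) * y ^ 5) / 2000) := by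
          ring
    _ ≤ y / 3 * (gaugeMeasure L).real (gaugeCore L (btEps β / 3)) * (Real.exp (-3) * (((L : ℝ) ^ 3) ^ (-(9 : ℝ) / 2) * β ^ (-(9 : ℝ) / 2)) / 2000) := by
          gcongr
    _ = _ := by rw [h92]

/-- The same without the Haar factor: `C'_L·(β^{-1})^6 ≤ β^{-1}/3 · e^{-3}(L³β)^{-9/2}/2000`. [folklore] -/
theorem budget_rhs_ge' {β : ℝ} (hβ1 : 1 ≤ β) :
    Real.exp (-3) * ((L : ℝ) ^ 3) ^ (-(9 : ℝ) / 2) / 6000 * powScale 1 β ^ 6 ≤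
      powScale 1 β / 3 * (Real.exp (-3) * ((L : ℝ) ^ 3 * β) ^ (-(9 : ℝ) / 2) / 2000) := by
  have hL0 : (0 : ℝ) < L := by exact_mod_cast NeZero.pos L
  have hβ0 : 0 < β := by linarith
  set y := powScale 1 β with hydef
  have hy0 : 0 < y := powScale_pos _ _
  have h92 : ((L : ℝ) ^ 3 * β) ^ (-(9 : ℝ) / 2) = ((L : ℝ) ^ 3) ^ (-(9 : ℝ) / 2) * β ^ (-(9 : ℝ) / 2) := Real.mul_rpow (by positivity) hβ0.le
  have hy5 : y ^ 5 ≤ β ^ (-(9 : ℝ) / 2) := by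
    have e : y ^ 5 = β ^ (-(5 : ℝ)) := by
      rw [hydef, powScale_eq hβ1, ← Real.rpow_mul_natCast hβ0.le]; norm_num
    rw [e]; exact Real.rpow_le_rpow_of_exponent_le hβ1 (by norm_num)
  have hL92 : 0 < ((L : ℝ) ^ 3) ^ (-(9 : ℝ) / 2) := Real.rpow_pos_of_pos (by positivity) _
  calc Real.exp (-3) * ((L : ℝ) ^ 3) ^ (-(9 : ℝ) / 2) / 6000 * y ^ 6 = y / 3 * (Real.exp (-3) * (((L : ℝ) ^ 3) ^ (-(9 : ℝ) / 2) * y ^ 5) / 2000) := by ring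
    _ ≤ y / 3 * (Real.exp (-3) * (((L : ℝ) ^ 3) ^ (-(9 : ℝ) / 2) * β ^ (-(9 : ℝ) / 2)) / 2000) := by gcongr
    _ = _ := by rw [h92]

/-! ## §5 ★★ The budget hypothesis, eventually -/

/-- ★★ **ALL SIX conjuncts of the budget hypothesis `hbudget` of `recordBT_hT_of_eventually`**, eventually (`0 < s < 1/2`). [folklore] -/
theorem eventually_budget {s : ℝ} (hs : 0 < s) (hs2 : s < 1 / 2) :
    ∀ᶠ β : ℝ in atTop, 1 ≤ (L : ℝ) ^ 3 * β ∧ 2 / rStar ^ 3 ≤ (L : ℝ) ^ 3 * β ∧ 2 * (btEps β / 3) < btR1 β ∧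
      Real.exp (β * ((Fintype.card (Edge 3 L) : ℝ) * (2 * (btEps β / 3) + 2 * Real.sqrt 2 * btRad β) ^ 2) +
            β * ((10 * Real.sqrt (Fintype.card (Plaquette 3 L × Fin 3)) * btRad β) ^ 2 + stepActionErr (L := L) (btRad β) 0)) *
          Real.exp (-(β * btMnt L (recordDelta1 L s β) (btAlpha β) (btRad β) (btR1 β) (btEps β))) ≤
        powScale 1 β / 3 * (gaugeMeasure L).real (gaugeCore L (btEps β / 3)) * (Real.exp (-3) * ((L : ℝ) ^ 3 * β) ^ (-(9 : ℝ) / 2) / 2000) ∧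
      Real.exp (β * ((Fintype.card (Edge 3 L) : ℝ) * (2 * (btEps β / 3) + 2 * Real.sqrt 2 * btRad β) ^ 2) +
            β * ((10 * Real.sqrt (Fintype.card (Plaquette 3 L × Fin 3)) * btRad β) ^ 2 + stepActionErr (L := L) (btRad β) 0)) *
          Real.exp (-(β * btMfar L (recordDelta1 L s β) (btAlpha β) (btRad β) (btEps β) (13 * recordDelta1 L s β))) ≤
        powScale 1 β / 3 * (gaugeMeasure L).real (gaugeCore L (btEps β / 3)) * (Real.exp (-3) * ((L : ℝ) ^ 3 * β) ^ (-(9 : ℝ) / 2) / 2000) ∧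
      Real.exp (-((L : ℝ) ^ 3 * β * btAlpha β ^ 2)) ≤ powScale 1 β / 3 * (Real.exp (-3) * ((L : ℝ) ^ 3 * β) ^ (-(9 : ℝ) / 2) / 2000) := by
  have hL1 : (1 : ℝ) ≤ L := by exact_mod_cast NeZero.one_le
  have hL0 : (0 : ℝ) < L := by linarith
  have hL3 : (1 : ℝ) ≤ (L : ℝ) ^ 3 := one_le_pow₀ hL1
  set K : ℝ := 14 * Fintype.card (Edge 3 L) + 100 * Fintype.card (Plaquette 3 L × Fin 3) + 1 with hKdef
  obtain ⟨C₁, hC₁, hrhs⟩ := budget_rhs_ge (L := L)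
  obtain ⟨q, hq, hfar⟩ := eventually_btMfar_ge (L := L) hs hs2
  have hC₃ : 0 < Real.exp (-3) * ((L : ℝ) ^ 3) ^ (-(9 : ℝ) / 2) / 6000 := by
    have : 0 < ((L : ℝ) ^ 3) ^ (-(9 : ℝ) / 2) := Real.rpow_pos_of_pos (by positivity) _
    positivity
  filter_upwards [eventually_budget_elementary (L := L), eventually_btM0_le (L := L), eventually_btMnt_ge (L := L) hs hs2, hfar,
    eventually_exp_logsq_le (K := K) one_pos hC₁ (3 * Fintype.card (Site 3 L) + 6),
    eventually_exp_logsq_le (K := K) hq hC₁ (3 * Fintype.card (Site 3 L) + 6), eventually_exp_logsq_le (K := 0) one_pos hC₃ 6,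
    eventually_ge_atTop (1 : ℝ), eventually_btLog_eq] with β hel hM hnt hfarβ hg1 hg2 hg3 hβ1 hℓeq
  obtain ⟨hB1, hB2, hρR⟩ := hel
  have hrhsβ := hrhs β hβ1
  have hrhs' := budget_rhs_ge' (L := L) hβ1
  refine ⟨hB1, hB2, hρR, ?_, ?_, ?_⟩
  · calc _ ≤ Real.exp K * Real.exp (-(Real.log β ^ 2)) :=
          mul_le_mul (Real.exp_le_exp.mpr hM) (Real.exp_le_exp.mpr (by linarith)) (Real.exp_pos _).le (Real.exp_pos _).le
      _ = Real.exp (K - 1 * Real.log β ^ 2) := by rw [← Real.exp_add]; congr 1; ring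
      _ ≤ _ := hg1.trans hrhsβ
  · calc _ ≤ Real.exp K * Real.exp (-(q * Real.log β ^ 2)) :=
          mul_le_mul (Real.exp_le_exp.mpr hM) (Real.exp_le_exp.mpr (by linarith)) (Real.exp_pos _).le (Real.exp_pos _).le
      _ = Real.exp (K - q * Real.log β ^ 2) := by rw [← Real.exp_add, sub_eq_add_neg]
      _ ≤ _ := hg2.trans hrhsβ
  · have hβx : β * powScale (1 / 2) β ^ 2 = 1 := mul_powScale_half_sq hβ1
    have hα : (L : ℝ) ^ 3 * β * btAlpha β ^ 2 = (L : ℝ) ^ 3 * Real.log β ^ 2 := by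
      unfold btAlpha; rw [hℓeq]
      calc (L : ℝ) ^ 3 * β * (powScale (1 / 2) β * Real.log β) ^ 2 = (L : ℝ) ^ 3 * Real.log β ^ 2 * (β * powScale (1 / 2) β ^ 2) := by ring
        _ = (L : ℝ) ^ 3 * Real.log β ^ 2 := by rw [hβx, mul_one]
    have hge : Real.log β ^ 2 ≤ (L : ℝ) ^ 3 * β * btAlpha β ^ 2 := by rw [hα]; exact le_mul_of_one_le_left (sq_nonneg _) hL3
    calc Real.exp (-((L : ℝ) ^ 3 * β * btAlpha β ^ 2)) ≤ Real.exp (0 - 1 * Real.log β ^ 2) := Real.exp_le_exp.mpr (by linarith)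
      _ ≤ _ := hg3.trans hrhs'

end Summit.QuantumFields.YangMills.Theorems.FemtoTransferGap.TwoLattice.ConstTube

end
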